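import Mathlib
import Summits.Ventures.Crystal3D.Theorems.StickyWulffConstantLayerChainDefs
import Summits.Ventures.Crystal3D.Theorems.StickyWulffConstantStackingLiminfLayerChainV4Defs
import Summits.Ventures.Crystal3D.Theorems.StickyWulffConstantStackingLiminfMollifierRegularity
import Summits.Ventures.Crystal3D.Theorems.StickyWulffConstantStackingLiminfStackTensionContinuity
import Summits.Ventures.Crystal3D.Theorems.StickyWulffConstantStackingLiminfClassL1
import Summits.Ventures.Crystal3D.Theorems.StickyWulffConstantStackingLiminfTaylorL1
import Summits.Ventures.Crystal3D.Theorems.StickyWulffConstantStackingLiminfEtaGradient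
import Summits.Ventures.Crystal3D.Theorems.StickyWulffConstantStackingLiminfLayerSplit
import Summits.Ventures.Crystal3D.Theorems.StickyWulffConstantStackingLiminfClassReduction
import Summits.Ventures.Crystal3D.Theorems.StickyWulffConstantStackingLiminfPairingPointwise
import Summits.Ventures.Crystal3D.Theorems.StickyWulffConstantStackingLiminfSkewTerm
import HarnessLib

/-!
# Stub (B) `MollifiedUpper` of line LayerChain v4 (crux `StackingLiminf`, stmt-Ventures-19145)
# REDUCED TO THE SKEW BOUND (S4): `mollifiedUpper_of_skewBound`

Cell `crystal3d-full`, venture `Summits/Ventures/Crystal3D`.  The kernel-checked assembly of BLUEPRINT-v4B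
(S1)+(S2)+(S3): for every Hägg word, every injective configuration in its Barlow stacking and all scales
`1 ≤ K ≤ L`,

`modTV (smooth x K L) (window σ K) ≤ √2·D + 384 M·N/K² + Σ_i ‖∂_{c_i} η_L‖₁ · ‖E‖₁`,

(`D = 6N − numContacts x`, `M` the Taylor constant of …TaylorL1, `E(y) = Σ_{i : σ(kf i) ≠ 1} φ_K(y − x_i) −
window σ K (y₂) · Σ_i φ_K(y − x_i)` the SKEW DENSITY).  Chain: layer split over a padded range (…LayerSplit),
pointwise pairing (…PairingPointwise ← …PairingBound = `stub_calibration`), `integral_mono_of_nonneg`, per-class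
`L¹` bounds (…ClassReduction ← …TaylorL1, …LateralCalculus) summed by S1 (`sum_class_l1_le`, p512839), skew term
(…SkewTerm ← …EtaGradient).  So **stub (B) follows from the skew bound** `‖E‖₁ ≤ C (K·D + N/K)` (hypothesis,
stated inline = BLUEPRINT S4: lateral quadrature at rate `1/K` suffices since the skew carries `1/L`, `L ≥ K`;
plus the occupied–vacant pair count), with `C₀ = 384 M + 12 C_η C + 1`.
WHAT THIS IS NOT: stub (B) unconditionally (S4 is open); rung F-C1 not moved.
-/

noncomputable section

namespace Summit.Ventures.Crystal3D.Theorems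

open MeasureTheory Set Function Metric Filter Topology
open Literature.MathematicalPhysics.StatisticalMechanics
open Summit.Ventures.Crystal3D.LayerChain (dot3 aVec bPlus bMinus stackTension)
open Summit.Ventures.Crystal3D.Cruxes.StackingLiminf.LayerChainV4
  (bump eta dens smooth window negGrad modTV MollifiedUpper)

variable {N : ℕ}

/-- Regrouping a sum over the `−1`-phase layers of a padded range as a sum over the `−1`-phase indices. -/
theorem sum_filter_layers {β : Type*} [AddCommMonoid β] (σ : ℤ → ℤ) (kf : Fin N → ℤ) (k₀ : ℤ) (m : ℕ)
    (hrange : ∀ i, k₀ ≤ kf i ∧ kf i < k₀ + m) (F : Fin N → β) :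
    ∑ n ∈ (Finset.range m).filter (fun n : ℕ => σ (k₀ + (n : ℤ)) ≠ 1),
        ∑ i ∈ Finset.univ.filter (fun i => kf i = k₀ + (n : ℤ)), F i =
      ∑ i ∈ Finset.univ.filter (fun i => σ (kf i) ≠ 1), F i := by
  classical
  rw [Finset.sum_filter, Finset.sum_filter, sum_eq_sum_range_layers kf k₀ m hrange]
  refine Finset.sum_congr rfl fun n _ => ?_
  by_cases h : σ (k₀ + (n : ℤ)) ≠ 1
  · rw [if_pos h]
    refine Finset.sum_congr rfl fun i hi => ?_
    have hk : kf i = k₀ + (n : ℤ) := (Finset.mem_filter.1 hi).2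
    rw [hk, if_pos h]
  · rw [if_neg h]
    symm
    refine Finset.sum_eq_zero fun i hi => ?_
    have hk : kf i = k₀ + (n : ℤ) := (Finset.mem_filter.1 hi).2
    rw [hk, if_neg h]

/-- The number of indices is the sum of the layer cardinalities over a padded range. -/
theorem card_eq_sum_card_layers (kf : Fin N → ℤ) (k₀ : ℤ) (m : ℕ)
    (hrange : ∀ i, k₀ ≤ kf i ∧ kf i < k₀ + m) :
    (N : ℝ) = ∑ n ∈ Finset.range m, ((Finset.univ.filter (fun i => kf i = k₀ + (n : ℤ))).card : ℝ) := by
  have h := sum_eq_sum_range_layers kf k₀ m hrange (fun _ : Fin N => (1 : ℝ))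
  simp only [Finset.sum_const, Finset.card_univ, Fintype.card_fin, nsmul_eq_mul, mul_one] at h
  exact h

/-- `smooth` as the lateral average of the full layer sum (definitional). -/
theorem smooth_eq_lateral_univ (x : Fin N → EuclideanSpace ℝ (Fin 3)) (K L : ℝ) :
    smooth x K L = fun y : Fin 3 → ℝ => ∫ z : ℝ × ℝ, eta L z *
      ∑ i, bump K ((fun j => y j - (![z.1, z.2, 0] : Fin 3 → ℝ) j) - WithLp.ofLp (x i)) := by
  funext y
  rfl

/-- **Stub (B) `MollifiedUpper` from the skew bound (BLUEPRINT-v4B S4).** -/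
theorem mollifiedUpper_of_skewBound
    (hE : ∃ C : ℝ, 0 ≤ C ∧ ∀ (N : ℕ) (σ : ℤ → ℤ), IsHaggSeq σ →
      ∀ x : Fin N → EuclideanSpace ℝ (Fin 3), Function.Injective x →
        (∀ i, x i ∈ barlowStacking 1 (Real.sqrt (2 / 3)) σ) →
        ∀ kf : Fin N → ℤ, (∀ i, x i 2 = kf i * Real.sqrt (2 / 3)) →
        ∀ K L : ℝ, 1 ≤ K → K ≤ L →
          ∫ y : Fin 3 → ℝ, |(∑ i ∈ Finset.univ.filter (fun i => σ (kf i) ≠ 1), bump K (y - WithLp.ofLp (x i))) -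
              window σ K (y 2) * ∑ i, bump K (y - WithLp.ofLp (x i))| ≤
            C * (K * (6 * (N : ℝ) - (Summit.Ventures.Crystal3D.numContacts x : ℝ)) + (N : ℝ) / K)) :
    MollifiedUpper := by
  classical
  obtain ⟨CE, hCE0, hE⟩ := hE
  obtain ⟨M, hM0, hM⟩ := exists_taylor_const_bump_one
  obtain ⟨Cη, hCη0, hCη⟩ := exists_eta_grad_const
  refine ⟨384 * M + 12 * Cη * CE + 1, by positivity, ?_⟩
  intro N σ hσ x hx hmem K L hK hKL
  have hK0 : 0 < K := by linarith
  have hL0 : 0 < L := by linarith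
  obtain ⟨kf, hkf⟩ := exists_layerMap x hmem
  set D : ℝ := 6 * (N : ℝ) - (Summit.Ventures.Crystal3D.numContacts x : ℝ) with hD
  -- a padded range of layers `k = k₀ + n`, `n < m`, containing every occupied layer in its interior
  obtain ⟨B, hB⟩ : ∃ B : ℕ, ∀ i, ((kf i).natAbs : ℤ) ≤ B :=
    ⟨∑ i, (kf i).natAbs, fun i => by
      exact_mod_cast Finset.single_le_sum (fun j _ => Nat.zero_le ((kf j).natAbs)) (Finset.mem_univ i)⟩
  set k₀ : ℤ := -(B : ℤ) - 1 with hk₀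
  set m : ℕ := 2 * B + 2 with hm
  have hrange : ∀ i, k₀ < kf i ∧ kf i < k₀ + m := by
    intro i
    have h1 := hB i
    have habs : (((kf i).natAbs : ℕ) : ℤ) = |kf i| := Int.natCast_natAbs (kf i)
    have h2 : kf i ≤ ((kf i).natAbs : ℤ) := by rw [habs]; exact le_abs_self _
    have h3 : -((kf i).natAbs : ℤ) ≤ kf i := by rw [habs]; exact neg_abs_le _
    constructor <;> push_cast [hk₀, hm] <;> omega
  have hrange' : ∀ i, k₀ ≤ kf i ∧ kf i < k₀ + m := fun i => ⟨(hrange i).1.le, (hrange i).2⟩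
  -- the layers, their lateral averages, the letters
  obtain ⟨T, hT⟩ : ∃ T : ℕ → Finset (Fin N), T = fun n : ℕ => Finset.univ.filter (fun i => kf i = k₀ + (n : ℤ)) :=
    ⟨_, rfl⟩
  obtain ⟨w, hw⟩ : ∃ w : ℕ → (Fin 3 → ℝ) → ℝ, w = fun n y => ∫ z : ℝ × ℝ, eta L z *
      ∑ i ∈ T n, bump K ((fun j => y j - (![z.1, z.2, 0] : Fin 3 → ℝ) j) - WithLp.ofLp (x i)) := ⟨_, rfl⟩
  obtain ⟨s, hs⟩ : ∃ s : ℕ → ℤ, s = fun n : ℕ => σ (k₀ + (n : ℤ)) := ⟨_, rfl⟩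
  have hTsucc : ∀ n : ℕ, T (n + 1) = Finset.univ.filter (fun i => kf i = k₀ + (n : ℤ) + 1) := by
    intro n; rw [hT]; push_cast; simp only [add_assoc]
  have hT0 : T 0 = ∅ := by
    rw [hT]
    simp only [CharP.cast_eq_zero, add_zero]
    refine Finset.filter_eq_empty_iff.2 fun i _ => ?_
    have := (hrange i).1; exact ne_of_gt this
  have hTm : T m = ∅ := by
    rw [hT]
    refine Finset.filter_eq_empty_iff.2 fun i _ => ?_
    have := (hrange i).2; exact ne_of_lt this
  have hw0 : ∀ y, w 0 y = 0 := by intro y; simp [hw, hT0]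
  have hwm : ∀ y, w m y = 0 := by intro y; simp [hw, hTm]
  have hwdiff : ∀ n y, DifferentiableAt ℝ (w n) y := by
    intro n y; rw [hw]; exact differentiableAt_lateral_layerSum x hK0 hL0 (T n) y
  have hsm : smooth x K L = fun y => ∑ n ∈ Finset.range m, w n y := by
    funext y; rw [smooth_eq_sum_layers x K hL0 kf k₀ m hrange' y, hw, hT]
  have hg : ∀ t, 0 ≤ window σ K t ∧ window σ K t ≤ 1 := fun t => window_mem_Icc σ hK t
  -- the `−1`-phase part and the total, as lateral averages of single layer sums
  have hWm : (fun y' => ∑ n ∈ (Finset.range m).filter (fun n => s n ≠ 1), w n y') =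
      fun y : Fin 3 → ℝ => ∫ z : ℝ × ℝ, eta L z *
        ∑ i ∈ Finset.univ.filter (fun i => σ (kf i) ≠ 1),
          bump K ((fun j => y j - (![z.1, z.2, 0] : Fin 3 → ℝ) j) - WithLp.ofLp (x i)) := by
    funext y
    rw [hw, hs]
    simp only
    rw [← integral_finsetSum]
    · refine integral_congr_ae (ae_of_all _ fun z => ?_)
      simp only
      rw [← Finset.mul_sum, hT]
      simp only
      rw [sum_filter_layers σ kf k₀ m hrange']
    · intro n _
      have hι : Continuous fun z : ℝ × ℝ => (fun j => y j - (![z.1, z.2, 0] : Fin 3 → ℝ) j) :=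
        continuous_pi fun j => by fin_cases j <;> simp <;> fun_prop
      refine PlateauHeight.integrable_eta_mul hL0 ?_
      exact continuous_finsetSum _ fun i _ => (continuous_bump K).comp (hι.sub continuous_const)
  have hWt : (fun y' => ∑ n ∈ Finset.range m, w n y') =
      fun y : Fin 3 → ℝ => ∫ z : ℝ × ℝ, eta L z *
        ∑ i, bump K ((fun j => y j - (![z.1, z.2, 0] : Fin 3 → ℝ) j) - WithLp.ofLp (x i)) := by
    rw [← hsm]; exact smooth_eq_lateral_univ x K L
  -- the skew directions
  have hc2 : ∀ i : Fin 3, (bPlus i - bMinus i) 2 = 0 := bPlus_sub_bMinus_apply_two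
  have hη1 : ContDiff ℝ 1 (eta L) := (contDiff_eta L).of_le (by norm_num)
  have hκc : ∀ i : Fin 3, Continuous fun z : ℝ × ℝ =>
      fderiv ℝ (eta L) z ((bPlus i - bMinus i) 0, (bPlus i - bMinus i) 1) :=
    fun i => (hη1.continuous_fderiv (by norm_num)).clm_apply continuous_const
  have hκs : ∀ i : Fin 3, HasCompactSupport fun z : ℝ × ℝ =>
      fderiv ℝ (eta L) z ((bPlus i - bMinus i) 0, (bPlus i - bMinus i) 1) :=
    fun i => (PlateauHeight.hasCompactSupport_eta hL0).fderiv_apply (𝕜 := ℝ) _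
  have hgc : Continuous (window σ K) := continuous_window σ hK
  -- (1) the pointwise bound
  have hpt : ∀ y, stackTension (window σ K (y 2)) (negGrad (smooth x K L) y) ≤
      (∑ i : Fin 3, ∑ n ∈ Finset.range m, |-(fderiv ℝ (w n) y (aVec i)) + w n y - w n y|) +
      (∑ n ∈ Finset.range m, ∑ i : Fin 3,
        |-(fderiv ℝ (w n) y (if s n = 1 then bPlus i else bMinus i)) + w n y - w (n + 1) y|) +
      ∑ i : Fin 3, |-(fderiv ℝ (fun y' => ∑ n ∈ (Finset.range m).filter (fun n => s n ≠ 1), w n y') y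
            (bPlus i - bMinus i)) +
          window σ K (y 2) * fderiv ℝ (fun y' => ∑ n ∈ Finset.range m, w n y') y (bPlus i - bMinus i)| := by
    intro y
    rw [hsm]
    exact stackTension_negGrad_le_layers w m s (window σ K) hg y (fun n => hwdiff n y) (hw0 y) (hwm y)
  -- (2) integrability of the three families
  have hIin : ∀ (i : Fin 3) (n : ℕ), Integrable fun y => -(fderiv ℝ (w n) y (aVec i)) + w n y - w n y := by
    intro i n; simp only [hw]; exact integrable_lateral_classDefect x hK0 hL0 (T n) (T n) (aVec i)
  have hIcr : ∀ (n : ℕ) (i : Fin 3), Integrable fun y =>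
      -(fderiv ℝ (w n) y (if s n = 1 then bPlus i else bMinus i)) + w n y - w (n + 1) y := by
    intro n i; simp only [hw]; exact integrable_lateral_classDefect x hK0 hL0 (T n) (T (n + 1)) _
  have hIsk : ∀ i : Fin 3, Integrable fun y : Fin 3 → ℝ =>
      -(fderiv ℝ (fun y' => ∑ n ∈ (Finset.range m).filter (fun n => s n ≠ 1), w n y') y
          (bPlus i - bMinus i)) +
        window σ K (y 2) * fderiv ℝ (fun y' => ∑ n ∈ Finset.range m, w n y') y (bPlus i - bMinus i) := by
    intro i
    rw [hWm, hWt]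
    have hprod := integrable_lateral_integrand _ (hκc i) (hκs i) _
      (continuous_skewDensity x K (Finset.univ.filter (fun i => σ (kf i) ≠ 1)) Finset.univ hgc)
      (hasCompactSupport_skewDensity x hK0 (Finset.univ.filter (fun i => σ (kf i) ≠ 1)) Finset.univ
        (window σ K))
    refine hprod.integral_prod_left.neg.congr (Eventually.of_forall fun y => ?_)
    simp only [uncurry, Pi.neg_apply]
    exact (skew_apply_eq x hK0 hL0 _ _ (window σ K) (hc2 i) y).symm
  have hIA : Integrable fun y => ∑ i : Fin 3, ∑ n ∈ Finset.range m,
      |-(fderiv ℝ (w n) y (aVec i)) + w n y - w n y| :=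
    integrable_finsetSum _ fun i _ => integrable_finsetSum _ fun n _ => (hIin i n).abs
  have hIB : Integrable fun y => ∑ n ∈ Finset.range m, ∑ i : Fin 3,
      |-(fderiv ℝ (w n) y (if s n = 1 then bPlus i else bMinus i)) + w n y - w (n + 1) y| :=
    integrable_finsetSum _ fun n _ => integrable_finsetSum _ fun i _ => (hIcr n i).abs
  have hIC : Integrable fun y : Fin 3 → ℝ => ∑ i : Fin 3,
      |-(fderiv ℝ (fun y' => ∑ n ∈ (Finset.range m).filter (fun n => s n ≠ 1), w n y') y
            (bPlus i - bMinus i)) +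
          window σ K (y 2) * fderiv ℝ (fun y' => ∑ n ∈ Finset.range m, w n y') y (bPlus i - bMinus i)| :=
    integrable_finsetSum _ fun i _ => (hIsk i).abs
  -- (3) integrate the pointwise bound
  have hmain : modTV (smooth x K L) (window σ K) ≤
      (∑ i : Fin 3, ∑ n ∈ Finset.range m, ∫ y, |-(fderiv ℝ (w n) y (aVec i)) + w n y - w n y|) +
      (∑ n ∈ Finset.range m, ∑ i : Fin 3,
        ∫ y, |-(fderiv ℝ (w n) y (if s n = 1 then bPlus i else bMinus i)) + w n y - w (n + 1) y|) +
      ∑ i : Fin 3, ∫ y : Fin 3 → ℝ,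
        |-(fderiv ℝ (fun y' => ∑ n ∈ (Finset.range m).filter (fun n => s n ≠ 1), w n y') y
            (bPlus i - bMinus i)) +
          window σ K (y 2) * fderiv ℝ (fun y' => ∑ n ∈ Finset.range m, w n y') y (bPlus i - bMinus i)| := by
    have hIAB : Integrable fun y : Fin 3 → ℝ =>
        (∑ i : Fin 3, ∑ n ∈ Finset.range m, |-(fderiv ℝ (w n) y (aVec i)) + w n y - w n y|) +
        (∑ n ∈ Finset.range m, ∑ i : Fin 3,
          |-(fderiv ℝ (w n) y (if s n = 1 then bPlus i else bMinus i)) + w n y - w (n + 1) y|) :=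
      hIA.add hIB
    have hIABC : Integrable fun y : Fin 3 → ℝ =>
        (∑ i : Fin 3, ∑ n ∈ Finset.range m, |-(fderiv ℝ (w n) y (aVec i)) + w n y - w n y|) +
        (∑ n ∈ Finset.range m, ∑ i : Fin 3,
          |-(fderiv ℝ (w n) y (if s n = 1 then bPlus i else bMinus i)) + w n y - w (n + 1) y|) +
        ∑ i : Fin 3, |-(fderiv ℝ (fun y' => ∑ n ∈ (Finset.range m).filter (fun n => s n ≠ 1), w n y') y
            (bPlus i - bMinus i)) +
          window σ K (y 2) * fderiv ℝ (fun y' => ∑ n ∈ Finset.range m, w n y') y (bPlus i - bMinus i)| :=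
      hIAB.add hIC
    have h := integral_mono_of_nonneg (μ := (volume : Measure (Fin 3 → ℝ)))
      (Eventually.of_forall fun y => ModulatedWulff.stackTension_nonneg (window σ K (y 2))
        (negGrad (smooth x K L) y)) hIABC (Eventually.of_forall hpt)
    unfold modTV
    refine le_trans h (le_of_eq ?_)
    rw [integral_add hIAB hIC, integral_add hIA hIB,
      integral_finsetSum _ fun i _ => integrable_finsetSum _ fun n _ => (hIin i n).abs,
      integral_finsetSum _ fun n _ => integrable_finsetSum _ fun i _ => (hIcr n i).abs,
      integral_finsetSum _ fun i _ => (hIsk i).abs]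
    congr 1
    congr 1
    · exact Finset.sum_congr rfl fun i _ => integral_finsetSum _ fun n _ => (hIin i n).abs
    · exact Finset.sum_congr rfl fun n _ => integral_finsetSum _ fun i _ => (hIcr n i).abs
  -- (4) the per-class bounds (S2 + lateral step)
  have hbin : ∀ (i : Fin 3) (n : ℕ), ∫ y, |-(fderiv ℝ (w n) y (aVec i)) + w n y - w n y| ≤
      (∫ y : Fin 3 → ℝ, |(∑ i' ∈ T n, bump K (y - WithLp.ofLp (x i' + WithLp.toLp 2 (aVec i)))) -
          ∑ i' ∈ T n, bump K (y - WithLp.ofLp (x i'))|) + ((T n).card : ℝ) * (64 * M / K ^ 2) := by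
    intro i n
    have h := integral_abs_lateral_classDefect_le hM0 hM x hK hL0 (T n) (T n) (norm_aVec_le i)
    simp only [hw]
    refine le_trans h (add_le_add le_rfl (mul_le_mul_of_nonneg_left ?_ (Nat.cast_nonneg _)))
    have h1 : ‖aVec i‖ ^ 2 ≤ 1 := by
      have := norm_aVec_le i; have := norm_nonneg (aVec i); nlinarith
    have : 64 * M * ‖aVec i‖ ^ 2 / K ^ 2 ≤ 64 * M * 1 / K ^ 2 := by
      apply div_le_div_of_nonneg_right _ (by positivity)
      exact mul_le_mul_of_nonneg_left h1 (by positivity)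
    simpa using this
  have hbcr : ∀ (n : ℕ) (i : Fin 3),
      ∫ y, |-(fderiv ℝ (w n) y (if s n = 1 then bPlus i else bMinus i)) + w n y - w (n + 1) y| ≤
      (∫ y : Fin 3 → ℝ, |(∑ i' ∈ T n, bump K (y - WithLp.ofLp (x i' +
          WithLp.toLp 2 (if s n = 1 then bPlus i else bMinus i)))) -
          ∑ i' ∈ T (n + 1), bump K (y - WithLp.ofLp (x i'))|) + ((T n).card : ℝ) * (64 * M / K ^ 2) := by
    intro n i
    have hb : ‖(if s n = 1 then bPlus i else bMinus i)‖ ≤ 1 := by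
      split_ifs
      · exact norm_bPlus_le i
      · exact norm_bMinus_le i
    have h := integral_abs_lateral_classDefect_le hM0 hM x hK hL0 (T n) (T (n + 1)) hb
    simp only [hw]
    refine le_trans h (add_le_add le_rfl (mul_le_mul_of_nonneg_left ?_ (Nat.cast_nonneg _)))
    have h1 : ‖(if s n = 1 then bPlus i else bMinus i)‖ ^ 2 ≤ 1 := by
      have := norm_nonneg (if s n = 1 then bPlus i else bMinus i); nlinarith
    have : 64 * M * ‖(if s n = 1 then bPlus i else bMinus i)‖ ^ 2 / K ^ 2 ≤ 64 * M * 1 / K ^ 2 := by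
      apply div_le_div_of_nonneg_right _ (by positivity)
      exact mul_le_mul_of_nonneg_left h1 (by positivity)
    simpa using this
  -- (5) the skew bound
  have hEx := hE N σ hσ x hx hmem kf hkf K L hK hKL
  have hbsk : ∀ i : Fin 3, ∫ y : Fin 3 → ℝ,
        |-(fderiv ℝ (fun y' => ∑ n ∈ (Finset.range m).filter (fun n => s n ≠ 1), w n y') y
            (bPlus i - bMinus i)) +
          window σ K (y 2) * fderiv ℝ (fun y' => ∑ n ∈ Finset.range m, w n y') y (bPlus i - bMinus i)| ≤
      (2 * Cη / L) * (CE * (K * D + (N : ℝ) / K)) := by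
    intro i
    rw [hWm, hWt]
    have h := integral_abs_skew_le x hK0 hL0 (Finset.univ.filter (fun i => σ (kf i) ≠ 1)) Finset.univ
      hgc (hc2 i)
    refine le_trans h ?_
    have hη := hCη L hL0 ((bPlus i - bMinus i) 0, (bPlus i - bMinus i) 1)
    have hηle : ∫ z : ℝ × ℝ, |fderiv ℝ (eta L) z ((bPlus i - bMinus i) 0, (bPlus i - bMinus i) 1)| ≤
        2 * Cη / L := by
      refine le_trans hη (div_le_div_of_nonneg_right ?_ hL0.le)
      have := norm_bPlus_sub_bMinus_lateral_le i
      nlinarith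
    exact mul_le_mul hηle hEx (integral_nonneg fun _ => abs_nonneg _) (by positivity)
  -- (6) S1: the sum of the sharp class terms is at most `√2 · D`
  have hS1 : ((∑ i : Fin 3, ∑ n ∈ Finset.range m,
      ∫ y : Fin 3 → ℝ, |(∑ i' ∈ T n, bump K (y - WithLp.ofLp (x i' + WithLp.toLp 2 (aVec i)))) -
          ∑ i' ∈ T n, bump K (y - WithLp.ofLp (x i'))|) +
      ∑ n ∈ Finset.range m, ∑ i : Fin 3,
        ∫ y : Fin 3 → ℝ, |(∑ i' ∈ T n, bump K (y - WithLp.ofLp (x i' +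
          WithLp.toLp 2 (if s n = 1 then bPlus i else bMinus i)))) -
          ∑ i' ∈ T (n + 1), bump K (y - WithLp.ofLp (x i'))|) ≤ Real.sqrt 2 * D := by
    have h := sum_class_l1_le hσ x hx hmem kf hkf hK0 ((Finset.range m).image fun n : ℕ => k₀ + (n : ℤ))
    rw [Finset.sum_image (fun a _ b _ hab => by exact_mod_cast add_left_cancel hab)] at h
    rw [Finset.sum_comm, ← Finset.sum_add_distrib]
    refine le_of_eq_of_le ?_ h
    refine Finset.sum_congr rfl fun n _ => ?_
    rw [← Finset.sum_add_distrib]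
    refine Finset.sum_congr rfl fun i _ => ?_
    rw [hTsucc n]
    simp only [hT, hs]
  have hD0 : 0 ≤ D := by
    have hs2 : (0 : ℝ) < Real.sqrt 2 := Real.sqrt_pos.2 (by norm_num)
    have h0 : (0 : ℝ) ≤ Real.sqrt 2 * D := le_trans (by positivity) hS1
    nlinarith
  -- (7) the layer cardinalities add up to `N`
  have hcard : ∑ n ∈ Finset.range m, ((T n).card : ℝ) = N := by
    rw [card_eq_sum_card_layers kf k₀ m hrange']
    simp only [hT]
  -- (8) assemble
  have hTay1 : ∑ i : Fin 3, ∑ n ∈ Finset.range m, ((T n).card : ℝ) * (64 * M / K ^ 2) =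
      3 * (64 * M / K ^ 2) * N := by
    rw [Finset.sum_const, Finset.card_univ, Fintype.card_fin, ← Finset.sum_mul, hcard]
    simp only [nsmul_eq_mul, Nat.cast_ofNat]
    ring
  have hTay2 : ∑ n ∈ Finset.range m, ∑ i : Fin 3, ((T n).card : ℝ) * (64 * M / K ^ 2) =
      3 * (64 * M / K ^ 2) * N := by
    simp only [Finset.sum_const, Finset.card_univ, Fintype.card_fin, nsmul_eq_mul, Nat.cast_ofNat]
    rw [← hcard, Finset.mul_sum]
    refine Finset.sum_congr rfl fun n _ => by ring
  have hsk3 : ∑ i : Fin 3, (2 * Cη / L) * (CE * (K * D + (N : ℝ) / K)) =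
      6 * Cη * CE * (K * D / L + (N : ℝ) / (K * L)) := by
    simp only [Finset.sum_const, Finset.card_univ, Fintype.card_fin, nsmul_eq_mul, Nat.cast_ofNat]
    field_simp
    ring
  have hNKL : (N : ℝ) / (K * L) ≤ (N : ℝ) / K ^ 2 := by
    apply div_le_div_of_nonneg_left (Nat.cast_nonneg _) (by positivity)
    nlinarith
  calc modTV (smooth x K L) (window σ K)
      ≤ (∑ i : Fin 3, ∑ n ∈ Finset.range m, ∫ y, |-(fderiv ℝ (w n) y (aVec i)) + w n y - w n y|) +
        (∑ n ∈ Finset.range m, ∑ i : Fin 3,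
          ∫ y, |-(fderiv ℝ (w n) y (if s n = 1 then bPlus i else bMinus i)) + w n y - w (n + 1) y|) +
        ∑ i : Fin 3, ∫ y : Fin 3 → ℝ,
          |-(fderiv ℝ (fun y' => ∑ n ∈ (Finset.range m).filter (fun n => s n ≠ 1), w n y') y
              (bPlus i - bMinus i)) +
            window σ K (y 2) * fderiv ℝ (fun y' => ∑ n ∈ Finset.range m, w n y') y (bPlus i - bMinus i)| :=
        hmain
    _ ≤ (∑ i : Fin 3, ∑ n ∈ Finset.range m,
          ((∫ y : Fin 3 → ℝ, |(∑ i' ∈ T n, bump K (y - WithLp.ofLp (x i' + WithLp.toLp 2 (aVec i)))) -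
              ∑ i' ∈ T n, bump K (y - WithLp.ofLp (x i'))|) + ((T n).card : ℝ) * (64 * M / K ^ 2))) +
        (∑ n ∈ Finset.range m, ∑ i : Fin 3,
          ((∫ y : Fin 3 → ℝ, |(∑ i' ∈ T n, bump K (y - WithLp.ofLp (x i' +
              WithLp.toLp 2 (if s n = 1 then bPlus i else bMinus i)))) -
              ∑ i' ∈ T (n + 1), bump K (y - WithLp.ofLp (x i'))|) + ((T n).card : ℝ) * (64 * M / K ^ 2))) +
        ∑ i : Fin 3, (2 * Cη / L) * (CE * (K * D + (N : ℝ) / K)) := by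
        gcongr with i _ n _ n _ i _ i _
        · exact hbin i n
        · exact hbcr n i
        · exact hbsk i
    _ = ((∑ i : Fin 3, ∑ n ∈ Finset.range m,
          ∫ y : Fin 3 → ℝ, |(∑ i' ∈ T n, bump K (y - WithLp.ofLp (x i' + WithLp.toLp 2 (aVec i)))) -
              ∑ i' ∈ T n, bump K (y - WithLp.ofLp (x i'))|) +
        ∑ n ∈ Finset.range m, ∑ i : Fin 3,
          ∫ y : Fin 3 → ℝ, |(∑ i' ∈ T n, bump K (y - WithLp.ofLp (x i' +
            WithLp.toLp 2 (if s n = 1 then bPlus i else bMinus i)))) -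
            ∑ i' ∈ T (n + 1), bump K (y - WithLp.ofLp (x i'))|) +
        (3 * (64 * M / K ^ 2) * N + 3 * (64 * M / K ^ 2) * N) +
        6 * Cη * CE * (K * D / L + (N : ℝ) / (K * L)) := by
        simp only [Finset.sum_add_distrib]
        rw [hTay1, hTay2, hsk3]
        ring
    _ ≤ Real.sqrt 2 * D + (3 * (64 * M / K ^ 2) * N + 3 * (64 * M / K ^ 2) * N) +
        6 * Cη * CE * (K * D / L + (N : ℝ) / K ^ 2) := by
        gcongr
    _ ≤ Real.sqrt 2 * D + (384 * M + 12 * Cη * CE + 1) * ((N : ℝ) / K ^ 2 + K * D / L) := by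
        set a : ℝ := (N : ℝ) / K ^ 2 with ha
        set b : ℝ := K * D / L with hb
        have h1 : 0 ≤ a := by positivity
        have h2 : 0 ≤ b := by positivity
        have h3 : 0 ≤ Cη * CE := by positivity
        have e1 : 3 * (64 * M / K ^ 2) * (N : ℝ) + 3 * (64 * M / K ^ 2) * (N : ℝ) = 384 * M * a := by
          rw [ha]; ring
        have key : Real.sqrt 2 * D + (384 * M + 12 * Cη * CE + 1) * (a + b) -
            (Real.sqrt 2 * D + 384 * M * a + 6 * Cη * CE * (b + a)) =
            384 * (M * b) + 6 * (Cη * CE * a) + 6 * (Cη * CE * b) + a + b := by ring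
        have hpos : 0 ≤ 384 * (M * b) + 6 * (Cη * CE * a) + 6 * (Cη * CE * b) + a + b := by positivity
        rw [e1]
        linarith

end Summit.Ventures.Crystal3D.Theorems

end
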